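import Summits.BirchSwinnertonDyer.Rank1Residual.X11b.RegMultKatoCertificate
import Summits.BirchSwinnertonDyer.Rank1Residual.X11b.CensusPAdicLeadingTermAntecedents
import HarnessLib

/-!
# Class X11b = N8 (census cell, seat `census-ctyper-2`, H-7 REG-MULT / SHAAN): the admissible
# SHAPES of a `#Ш_an prime to p` certificate feeding the partner-free Kato road (p253610 / p254954)
# — what a NUMERICAL row can and cannot discharge

HONEST FRAMING (verbatim, cell `b2b-bsdres`, run/shared/lean/b2b/bsd-rank1-residual/): the goal of
the cell is to DELETE the COMBINATION-SHAPED residual classes for ALL analytic-rank `≤ 1` curves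
over `ℚ` — 'full BSD formula for every rank `≤ 1` curve in class C' assembled STRICTLY from
published theorems — so that the rank-`≤ 1` remainder becomes exactly the CONSTRUCTION-SHAPED
classes, which are TYPED (missing-input Props), NOT attempted; this is not 'finishing BSD'.
Research routes; no claim beyond stated classes; census / instrument output = EVIDENCE /
certificate rows (instrumentation tier — what a certified row is worth is referee A's / the
director's ruling), never a Literature fact; nothing here books anything or changes a label or a
RESIDUAL-MAP mark; class X11b stays CONSTRUCTION-SHAPED.

## Why this file (census-lead GEN 7 A-49 'SHAAN5' offer, format by census-ctyper-2)

`RegMult.bsdp_of_katoSurj_of_cert_of_padicValRat_shaAn_le` (p254954) closes `BSD(E,p)` on a `¬Ram`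
N8 cell from the PUBLISHED facts + ONE REGMULT row + the per-pair input
`hv : padicValRat p s ≤ 0` for THE rational `s = #Ш(E)_an` (`shaAn W = s`; `s ∈ ℚ^×` in analytic
rank one is Gross–Zagier I.(7.3) + GZK, tree fact `GrossZagier1986_thm_I_7_3`). The census lane can
produce two kinds of row towards `hv`, and they are NOT of the same logical kind:

* **(S-REAL) an archimedean two-engine BALL** `|#Ш_an - n| < ε` around an integer `n` with `p ∤ n`
  (`L'(E,1)`, `Ω`, `Reg_∞`, `∏c`, `#T` to high precision; PARI `lfun` + an Arb engine). A ball
  determines the NEAREST INTEGER, never the `p`-adic valuation of the rational number inside it: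
  `s = n·p^k/(p^k - 1)` lies within `n/(p^k - 1)` of `n` and has `ord_p s = k > 0`. So a ball
  discharges `hv` ONLY together with an EXACTNESS input — `#Ш_an ∈ ℤ` (BSD predicts it; NOT a
  theorem in analytic rank one: rationality is, integrality is not) or a DENOMINATOR BOUND
  `den(#Ш_an) ≤ D` with `ε ≤ 1/D` (no such bound is in print for rank one; the primes where
  `BSD(E,ℓ)` is known do not bound the exponents at the others). §1 below makes this precise:
  `Rat.eq_intCast_of_den_le_of_abs_sub_lt` (a rational with denominator `≤ D` within `1/D` of an
  integer IS that integer) and `bsdp_of_katoSurj_of_cert_of_shaAnBall` = p254954 with `hv` replaced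
  by (ball ∧ denominator bound ∧ `p ∤ n`) — the denominator bound `hden` is the typed, UNDISCHARGED
  input of an S-REAL row (with `D = 1` it reads `#Ш_an ∈ ℤ`).
* **(S-PADIC) an EXACT `p`-adic valuation row.** Granted the PRINTED leading-term identity at the
  pair (non-split `p`: Disegni 2020 Thm. 4 •1, tree fact `Disegni2020.padicBSD_nonsplitMult_rankOne`,
  every odd `p`; split `p ≥ 5`, `E[p]` irreducible, a second multiplicative prime: Thm. 4 •2,
  `Disegni2020.padicBSD_splitMult_rankOne`), `ord_p #Ш_an` is an INTEGER COMBINATION OF CERTIFIABLE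
  VALUATIONS: `ord_p s = v(ϖ·[T¹]L·log_p γ) + 2·ord_p #T - v(Reg_p(Dh)) - ord_p ∏c` (non-split;
  `§2`, `padicValRat_eq_of_identity_nonsplit`), resp. with `[T²]L·log_p(γ)²` and `- v(𝓛_p)` (split).
  Here `ϖ·[T^k]L·log_p(γ)^k = A_k/(k!·c_∞)` is PARI's `ellpadicL` derivative (modular symbols: exact
  `p`-adic digits, valuation certified by one non-zero digit at two precisions / two engines),
  `v(Reg_p(Dh))` is the REGMULT row's `v` for THE Stein–Wuthrich height PROVIDED the point is
  `p`-SATURATED (`Reg_p = h_p(P)/k²`, `k = [E(ℚ)/tors : ⟨P⟩]`; an unsaturated `P` inflates `v` by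
  `2·ord_p k` and would make `#Ш_an` look LESS divisible by `p` — unsound; the saturation witness is a
  finite exact check, schema `SHAAN-CERT-SCHEMA.md` §3), `#T`, `∏c` exact (Tate's algorithm). NO
  rounding hypothesis: `§2`'s `bsdp_of_katoSurj_of_certNonsplit_of_leadingCoeffVal` is p254954 with
  `hv` DERIVED from fact A185 + two valuation certificates + the inequality
  `a + 2·ord_p #T ≤ b + ord_p ∏c`; the split twin uses A186 and `v(𝓛_p)`. This is the census's
  "valuation reading" (`X11-REPORT.md` v3.2 §5b, `v_p(D/Reg_p) = v_p(#Ш_an)` calibrated 984/984) made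
  a kernel deduction. Its price is the ENGINE: modular symbols at level `N` (memory-bound; the 138
  `¬Ram` cells have `N ≤ 485 100`, beyond `msfromell` — PLAN.md §8.2 B4 engine), versus S-REAL's
  `O(√N)` `L`-series.

Both are per-pair computed inputs (EVIDENCE, instrumentation tier); what either is worth for a
booking is referee A's D-a′ ruling, not this file's. The dictionary PARI ↔ tree (which engine
quantity is `ϖ·[T¹]L·log_p γ`) is the documentation reading recorded in `CensusPAdicLeadingTerm`
(module docstring), corroborated by calibration, not a kernel fact.

## Contents (theorems only; 0 definitions, 0 named facts)

§1 `Rat.eq_intCast_of_den_le_of_abs_sub_lt`, `Rat.eq_intCast_of_eq_intCast_of_abs_sub_lt`,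
`RegMult.padicValRat_le_zero_of_ball_of_den_le`, `RegMult.bsdp_of_katoSurj_of_cert_of_shaAnBall`.
§2 `RegMult.padicValRat_eq_of_identity_nonsplit`, `RegMult.padicValRat_eq_of_identity_split`
(pure valuation bookkeeping of the two identity shapes), `RegMult.padicValRat_le_zero_of_identity_
{nonsplit,split}_of_vals`, `RegMult.padicValRat_shaAn_le_zero_of_disegni_nonsplit_of_vals` (A185
instantiated), `RegMult.bsdp_of_katoSurj_of_certNonsplit_of_leadingCoeffVal` (end-to-end, non-split
`¬Ram` cell, `p ≥ 5`), `RegMult.bsdp_of_katoSurj_of_certSplit_of_leadingCoeffVal` (split, A186, (∗)).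

References: [Miller2011LMS] Def. 1.1 (`BSD(E,p)`, `#Ш_an`); [GrossZagier1986] Thm. I.(7.3)
(rationality); [Disegni2020] Thm. 4 (•1 non-split exact, •2 split with a second multiplicative
prime); [Wuthrich2014] Thm. 3; [SteinWuthrich2013] Thm. 6.1, §4.2; [MazurTateTeitelbaum1986Invent]
§II.10 (the `p`-adic BSD shape).
-/

set_option autoImplicit false

/-! ### §1 (S-REAL) A ball around `#Ш_an` needs a denominator bound to pin the rational -/

/-- **A rational with denominator `≤ D` within `1/D` of an integer IS that integer.** If
`s.den ≤ D` and `|s - n| < 1/D` then `s = n`: `(s - n)·s.den = s.num - n·s.den` is an integer of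
absolute value `< s.den/D ≤ 1`. (With `D = 0` the hypothesis `|s - n| < 1/0 = 0` is absurd.) This is
the EXACTNESS input an archimedean certificate of `#Ш_an` needs and does not itself supply.
[folklore] -/
theorem Rat.eq_intCast_of_den_le_of_abs_sub_lt {s : ℚ} {n : ℤ} {D : ℕ} (hD : s.den ≤ D)
    (h : |s - n| < 1 / D) : s = n := by
  have hden : (0 : ℚ) < s.den := by exact_mod_cast s.den_pos
  have hDq : (s.den : ℚ) ≤ D := by exact_mod_cast hD
  have hDpos : (0 : ℚ) < D := lt_of_lt_of_le hden hDq
  have hint : (s - n) * s.den = ((s.num - n * s.den : ℤ) : ℚ) := by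
    push_cast
    rw [sub_mul, Rat.mul_den_eq_num]
  have habs : |((s.num - n * s.den : ℤ) : ℚ)| < 1 := by
    rw [← hint, abs_mul, abs_of_pos hden]
    calc |s - ↑n| * ↑s.den < 1 / ↑D * ↑s.den := mul_lt_mul_of_pos_right h hden
      _ ≤ 1 / ↑D * ↑D := by gcongr
      _ = 1 := one_div_mul_cancel hDpos.ne'
  have hz : (s.num - n * s.den : ℤ) = 0 := by
    have h1 : |(s.num - n * s.den : ℤ)| < 1 := by exact_mod_cast habs
    exact Int.abs_lt_one_iff.mp h1
  have h0 : (s - n) * s.den = 0 := by rw [hint, hz, Int.cast_zero]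
  rcases mul_eq_zero.mp h0 with h0 | h0
  · exact sub_eq_zero.mp h0
  · exact absurd h0 hden.ne'

/-- **Integer case (`D = 1`): an integer-valued rational within `1` of an integer is that integer.**
The shape of the rounding step when `#Ш_an ∈ ℤ` is GIVEN (`hz`). [folklore] -/
theorem Rat.eq_intCast_of_eq_intCast_of_abs_sub_lt {s : ℚ} {n z : ℤ} (hz : s = z)
    (h : |s - n| < 1) : s = n := by
  subst hz
  have hden : (z : ℚ).den ≤ 1 := by simp
  exact Rat.eq_intCast_of_den_le_of_abs_sub_lt hden (by simpa using h)

noncomputable section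

open scoped Classical MatrixGroups ModularForm

open CongruenceSubgroup WeierstrassCurve
open Literature.NumberTheory.EllipticCurves
  Literature.NumberTheory.EllipticCurves.ModularForms
  Literature.NumberTheory.EllipticCurves.Rank1Residual
  Literature.NumberTheory.EllipticCurves.Rank1Residual.Typed
  Literature.NumberTheory.EllipticCurves.Wuthrich2014
  Literature.NumberTheory.EllipticCurves.SteinWuthrich2013
  Literature.NumberTheory.EllipticCurves.Disegni2020
  Literature.NumberTheory.EllipticCurves.Skinner2016

namespace Summit.BirchSwinnertonDyer.Rank1Residual.X11b

namespace RegMult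

section Real

variable (W : WeierstrassCurve ℚ) [W.IsElliptic] [W.IsGloballyMinimal] (p : ℕ) [Fact p.Prime]

omit [W.IsElliptic] [W.IsGloballyMinimal] [Fact p.Prime] in
/-- **An S-REAL row in the kernel's currency**: a rational `s` (`= #Ш_an`) with a denominator bound
`s.den ≤ D`, a ball `|s - n| < 1/D` around a natural number `n`, and `p ∤ n`, give
`padicValRat p s ≤ 0` (indeed `s = n`). The ball and `p ∤ n` are what the two engines deliver; the
bound `hden` is NOT delivered by any engine (EXACTNESS input; `D = 1` = '`#Ш_an ∈ ℤ`').
[cite: Miller2011LMS, Def. 1.1] -/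
theorem padicValRat_le_zero_of_ball_of_den_le {s : ℚ} {D : ℕ} (hden : s.den ≤ D) {n : ℕ}
    (hball : |s - n| < 1 / D) (hn : ¬ p ∣ n) : padicValRat p s ≤ 0 := by
  have hsn : s = (n : ℤ) :=
    Rat.eq_intCast_of_den_le_of_abs_sub_lt hden (by simpa using hball)
  rw [hsn, Int.cast_natCast]
  exact padicValRat_natCast_le_zero_of_not_dvd p hn

/-- **Per-pair closure from ONE REGMULT row + an S-REAL `#Ш_an` row + its EXACTNESS input**
(either reduction sign; `hcs`/`hstar` used iff split, `hcn` iff non-split): p254954's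
`bsdp_of_katoSurj_of_cert_of_padicValRat_shaAn_le` with `hv` replaced by a denominator bound
`hden : s.den ≤ D` (UNDISCHARGED by the row — typed input; `D = 1` reads `#Ш_an ∈ ℤ`), the
two-engine ball `hball : |s - n| < 1/D` and `p ∤ n`. CONDITIONAL on the named facts (Kato–Wuthrich
A32, Stein–Wuthrich 6.1/§4.2, Disegni Thm. 1, GZK, modularity); per pair; nothing booked; the
S-REAL row WITHOUT `hden` is evidence about the nearest integer only.
[cite: Wuthrich2014, Thm. 3 (p. 383)] [cite: SteinWuthrich2013, Thm. 6.1, §4.2]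
[cite: Disegni2020, Thm. 1 (§1.2), (∗)] [cite: Miller2011LMS, Def. 1.1, Prop. 7.6] -/
theorem bsdp_of_katoSurj_of_cert_of_shaAnBall
    (hK : kato_charIdeal_dvd_multiplicative_of_surjective)
    (hJn : thm61_nonsplitMultiplicative) (hJs : thm61_splitMultiplicative)
    (hHn : exists_isMultCanonical) (hHs : exists_isSplitMultCanonical)
    (hD : thm1_padicBSD_rankOne_multiplicative)
    (hGZK : rank_eq_analyticRank_of_analyticRank_le_one) (hpar : nonempty_modularParametrizationData)
    (hp5 : 5 ≤ p) (hX : ClassX11b W p) (hsurj : Surj W p)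
    (hstar : W.HasSplitMultiplicativeReductionAtPrime p →
      ∃ (m : ℕ) (_ : Fact m.Prime), m ≠ p ∧ W.HasMultiplicativeReductionAtPrime m)
    {P : W.toAffine.Point} {m : ℕ}
    (hcn : ¬ W.HasSplitMultiplicativeReductionAtPrime p → CertNonsplit W p P m)
    (hcs : W.HasSplitMultiplicativeReductionAtPrime p → CertSplit W p P m)
    {s : ℚ} (hs : shaAn W = (s : ℂ)) {D : ℕ} (hden : s.den ≤ D) {n : ℕ}
    (hball : |s - n| < 1 / D) (hn : ¬ p ∣ n) : BSDp W p :=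
  bsdp_of_katoSurj_of_cert_of_padicValRat_shaAn_le W p hK hJn hJs hHn hHs hD hGZK hpar hp5 hX hsurj
    hstar hcn hcs hs (padicValRat_le_zero_of_ball_of_den_le p hden hball hn)

end Real

/-! ### §2 (S-PADIC) `ord_p #Ш_an` from the printed leading-term identity and exact valuations -/

section Padic

variable (W : WeierstrassCurve ℚ) [W.IsElliptic] (p : ℕ) [Fact p.Prime]

/-- **Valuation bookkeeping of the NON-SPLIT identity shape** `X · #T² = 2 · (s · R · ∏c)` in `ℚ_p`
(`X = ϖ·[T¹]L·log_p γ_cyc`, `R = Reg_p(E, Dh)`; the shape of `CensusLeadingTermNonsplit` (ii) and of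
Disegni 2020 Thm. 4 •1): for `p ≠ 2`, `s ≠ 0`, `R ≠ 0`,
`ord_p s = v(X) + 2·ord_p #T - v(R) - ord_p ∏c`. Pure algebra of `Padic.valuation`.
[cite: Disegni2020, Thm. 4 (first bullet)] [cite: MazurTateTeitelbaum1986Invent, §II.10] -/
theorem padicValRat_eq_of_identity_nonsplit (hp : p ≠ 2) {X R : ℚ_[p]} {s : ℚ} (hs0 : s ≠ 0)
    (hR : R ≠ 0)
    (hid : X * (W.torsionOrder : ℚ_[p]) ^ 2 = 2 * ((s : ℚ_[p]) * R * W.tamagawaProduct)) :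
    padicValRat p s = X.valuation + 2 * (padicValNat p W.torsionOrder : ℤ) - R.valuation -
      (padicValNat p W.tamagawaProduct : ℤ) := by
  have hT : (W.torsionOrder : ℚ_[p]) ≠ 0 := by exact_mod_cast (W.torsionOrder_pos_holds).ne'
  have hC : (W.tamagawaProduct : ℚ_[p]) ≠ 0 := by
    exact_mod_cast (W.tamagawaProduct_pos_holds : 0 < W.tamagawaProduct).ne'
  have hs : (s : ℚ_[p]) ≠ 0 := by exact_mod_cast hs0
  have h2 : (2 : ℚ_[p]) ≠ 0 := two_ne_zero
  have hX : X ≠ 0 := by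
    intro hX0
    rw [hX0, zero_mul] at hid
    exact (mul_ne_zero h2 (mul_ne_zero (mul_ne_zero hs hR) hC)) hid.symm
  have hv2 : (2 : ℚ_[p]).valuation = 0 := by
    rw [show (2 : ℚ_[p]) = ((2 : ℕ) : ℚ_[p]) by norm_num, Padic.valuation_natCast,
      padicValNat.eq_zero_of_not_dvd (fun h ↦ hp ((Nat.prime_dvd_prime_iff_eq (Fact.out) Nat.prime_two).mp h))]
    rfl
  have key := congrArg Padic.valuation hid
  rw [Padic.valuation_mul hX (pow_ne_zero 2 hT), Padic.valuation_pow,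
    Padic.valuation_mul h2 (mul_ne_zero (mul_ne_zero hs hR) hC),
    Padic.valuation_mul (mul_ne_zero hs hR) hC, Padic.valuation_mul hs hR, hv2,
    Padic.valuation_ratCast, Padic.valuation_natCast, Padic.valuation_natCast] at key
  omega

/-- **Valuation bookkeeping of the SPLIT identity shape** `X · #T² = 𝓛 · (s · R · ∏c)`
(`X = ϖ·[T²]L·log_p(γ_cyc)²`, `𝓛 = 𝓛_p(E) ≠ 0`; the shape of `CensusLeadingTermSplit` (ii) and of
Disegni 2020 Thm. 4 •2): for `s ≠ 0`, `R ≠ 0`,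
`ord_p s = v(X) + 2·ord_p #T - v(𝓛) - v(R) - ord_p ∏c`. [cite: Disegni2020, Thm. 4 (second bullet)]
[cite: MazurTateTeitelbaum1986Invent, §II.10] -/
theorem padicValRat_eq_of_identity_split {X Λ R : ℚ_[p]} {s : ℚ} (hs0 : s ≠ 0) (hΛ : Λ ≠ 0)
    (hR : R ≠ 0)
    (hid : X * (W.torsionOrder : ℚ_[p]) ^ 2 = Λ * ((s : ℚ_[p]) * R * W.tamagawaProduct)) :
    padicValRat p s = X.valuation + 2 * (padicValNat p W.torsionOrder : ℤ) - Λ.valuation -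
      R.valuation - (padicValNat p W.tamagawaProduct : ℤ) := by
  have hT : (W.torsionOrder : ℚ_[p]) ≠ 0 := by exact_mod_cast (W.torsionOrder_pos_holds).ne'
  have hC : (W.tamagawaProduct : ℚ_[p]) ≠ 0 := by
    exact_mod_cast (W.tamagawaProduct_pos_holds : 0 < W.tamagawaProduct).ne'
  have hs : (s : ℚ_[p]) ≠ 0 := by exact_mod_cast hs0
  have hX : X ≠ 0 := by
    intro hX0
    rw [hX0, zero_mul] at hid
    exact (mul_ne_zero hΛ (mul_ne_zero (mul_ne_zero hs hR) hC)) hid.symm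
  have key := congrArg Padic.valuation hid
  rw [Padic.valuation_mul hX (pow_ne_zero 2 hT), Padic.valuation_pow,
    Padic.valuation_mul hΛ (mul_ne_zero (mul_ne_zero hs hR) hC),
    Padic.valuation_mul (mul_ne_zero hs hR) hC, Padic.valuation_mul hs hR,
    Padic.valuation_ratCast, Padic.valuation_natCast, Padic.valuation_natCast] at key
  omega

/-- **NON-SPLIT: `ord_p #Ш_an ≤ 0` from the identity and two certified valuations.** If
`v(X) = a` (leading-coefficient valuation row) and `v(Reg_p(Dh)) = b` (REGMULT row of a
`p`-saturated point) with `a + 2·ord_p #T ≤ b + ord_p ∏c`, then `padicValRat p s ≤ 0` — the input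
`hv` of the Kato road, WITHOUT any rounding hypothesis (for `s = 0` trivially).
[cite: Disegni2020, Thm. 4 (first bullet)] [cite: Miller2011LMS, Def. 1.1] -/
theorem padicValRat_le_zero_of_identity_nonsplit_of_vals (hp : p ≠ 2) {X R : ℚ_[p]} {s : ℚ}
    (hR : R ≠ 0)
    (hid : X * (W.torsionOrder : ℚ_[p]) ^ 2 = 2 * ((s : ℚ_[p]) * R * W.tamagawaProduct))
    {a b : ℤ} (ha : X.valuation = a) (hb : R.valuation = b)
    (hle : a + 2 * (padicValNat p W.torsionOrder : ℤ) ≤ b + (padicValNat p W.tamagawaProduct : ℤ)) :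
    padicValRat p s ≤ 0 := by
  by_cases hs0 : s = 0
  · simp [hs0]
  · rw [padicValRat_eq_of_identity_nonsplit W p hp hs0 hR hid, ha, hb]
    omega

/-- **SPLIT: `ord_p #Ш_an ≤ 0` from the identity and three certified valuations** (`v(X) = a`,
`v(𝓛_p) = l`, `v(Reg_p(Dh)) = b`, `a + 2·ord_p #T ≤ l + b + ord_p ∏c`).
[cite: Disegni2020, Thm. 4 (second bullet)] [cite: Miller2011LMS, Def. 1.1] -/
theorem padicValRat_le_zero_of_identity_split_of_vals {X Λ R : ℚ_[p]} {s : ℚ} (hΛ : Λ ≠ 0)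
    (hR : R ≠ 0)
    (hid : X * (W.torsionOrder : ℚ_[p]) ^ 2 = Λ * ((s : ℚ_[p]) * R * W.tamagawaProduct))
    {a l b : ℤ} (ha : X.valuation = a) (hl : Λ.valuation = l) (hb : R.valuation = b)
    (hle : a + 2 * (padicValNat p W.torsionOrder : ℤ) ≤
      l + b + (padicValNat p W.tamagawaProduct : ℤ)) :
    padicValRat p s ≤ 0 := by
  by_cases hs0 : s = 0
  · simp [hs0]
  · rw [padicValRat_eq_of_identity_split W p hs0 hΛ hR hid, ha, hl, hb]
    omega

/-- **NON-SPLIT, from the PRINTED theorem**: granted the named fact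
`Disegni2020.padicBSD_nonsplitMult_rankOne` (A185; Disegni 2020 Thm. 4 •1, every odd `p`), for `W`
globally minimal of analytic rank one, non-split multiplicative at `p ≠ 2`, THE objects of the
identity (`q`, the newform `f`, THE `p`-adic `L`-function `L`, THE Stein–Wuthrich height `Dh`,
`ϖ·Ω_E = Ω⁺_f`) with `Reg_p(E, Dh) ≠ 0`, and certified valuations `v(ϖ·[T¹]L·log_p γ) = a`,
`v(Reg_p(Dh)) = b` with `a + 2·ord_p #T ≤ b + ord_p ∏c`: `ord_p #Ш_an ≤ 0`. EXACT (no rounding);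
conditional on A185 and on the engine dictionary. [cite: Disegni2020, Thm. 4 (first bullet)] -/
theorem padicValRat_shaAn_le_zero_of_disegni_nonsplit_of_vals [W.IsGloballyMinimal]
    (hA : Disegni2020.padicBSD_nonsplitMult_rankOne) (hp : p ≠ 2)
    (hmult : W.HasMultiplicativeReductionAtPrime p)
    (hns : ¬ W.HasSplitMultiplicativeReductionAtPrime p) (hr : W.analyticRank = 1)
    {q : ℚ_[p]} (hq0 : q ≠ 0) (hq1 : ‖q‖ < 1) (hqj : tateJ q = (W.j : ℚ_[p]))
    {N : ℕ} [NeZero N] {f : CuspForm (Gamma0 N) 2} (hf : IsNewformOf W f)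
    {L : PowerSeries ℚ_[p]} (hL : IsMultPAdicLFunctionOf f p (-1) L)
    {Dh : PAdicHeightData W p} (hDh : IsMultCanonical Dh q) (hReg : padicRegulator Dh ≠ 0)
    {ϖ : ℚ} (hϖ : (ϖ : ℝ) * W.realPeriodRat = plusPeriod f) {s : ℚ} (hs : shaAn W = (s : ℂ))
    {a b : ℤ}
    (ha : ((ϖ : ℚ_[p]) * PowerSeries.coeff 1 L * padicLog p (cyclotomicGenerator p)).valuation = a)
    (hb : (padicRegulator Dh).valuation = b)
    (hle : a + 2 * (padicValNat p W.torsionOrder : ℤ) ≤ b + (padicValNat p W.tamagawaProduct : ℤ)) :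
    padicValRat p s ≤ 0 :=
  padicValRat_le_zero_of_identity_nonsplit_of_vals W p hp hReg
    (censusLeadingTermNonsplit_identity_of_disegni W p hA hp hmult hns hr hq0 hq1 hqj hf hL hDh hϖ hs)
    ha hb hle

variable [W.IsGloballyMinimal]

/-- **Per-pair closure, NON-SPLIT `¬Ram` cell, from ONE REGMULT row + an S-PADIC row — NO rounding
hypothesis.** `ClassX11b W p`, `p ≥ 5`, `ρ̄_{E,p}` onto, `E` non-split at `p`, ONE row
`RegMult.CertNonsplit W p P m` (`hc`), THE objects of the leading-term identity at the pair and the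
two EXACT valuation certificates `ha` (leading coefficient `ϖ·[T¹]L·log_p γ = A₁/c_∞`, modular
symbols) and `hb` (THE height's regulator; = the REGMULT row's `v` for a `p`-saturated point) with
`a + 2·ord_p #T ≤ b + ord_p ∏c` ⇒ `BSD(E,p)`, from Kato–Wuthrich A32 (`hK`), Stein–Wuthrich 6.1 /
§4.2 (`hJn hHn`), Disegni Thm. 1 (`hD`) AND Thm. 4 •1 (`hA`, A185 — converts the computed valuation
into `ord_p #Ш_an ≤ 0`), GZK, modularity. Both per-pair inputs are finite EXACT certificates
(EVIDENCE, instrumentation tier); nothing booked; X11b stays CONSTRUCTION-SHAPED.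
[cite: Wuthrich2014, Thm. 3 (p. 383)] [cite: SteinWuthrich2013, Thm. 6.1 (p. 20), §4.2 (p. 15)]
[cite: Disegni2020, Thm. 1 (§1.2); Thm. 4 (first bullet)] [cite: Miller2011LMS, Def. 1.1, Prop. 7.6] -/
theorem bsdp_of_katoSurj_of_certNonsplit_of_leadingCoeffVal
    (hK : kato_charIdeal_dvd_multiplicative_of_surjective) (hJn : thm61_nonsplitMultiplicative)
    (hHn : exists_isMultCanonical) (hD : thm1_padicBSD_rankOne_multiplicative)
    (hA : Disegni2020.padicBSD_nonsplitMult_rankOne)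
    (hGZK : rank_eq_analyticRank_of_analyticRank_le_one) (hpar : nonempty_modularParametrizationData)
    (hp5 : 5 ≤ p) (hX : ClassX11b W p) (hsurj : Surj W p)
    (hns : ¬ W.HasSplitMultiplicativeReductionAtPrime p)
    {P : W.toAffine.Point} {m : ℕ} (hc : CertNonsplit W p P m)
    {q : ℚ_[p]} (hq0 : q ≠ 0) (hq1 : ‖q‖ < 1) (hqj : tateJ q = (W.j : ℚ_[p]))
    {N : ℕ} [NeZero N] {f : CuspForm (Gamma0 N) 2} (hf : IsNewformOf W f)
    {L : PowerSeries ℚ_[p]} (hL : IsMultPAdicLFunctionOf f p (-1) L)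
    {Dh : PAdicHeightData W p} (hDh : IsMultCanonical Dh q)
    {ϖ : ℚ} (hϖ : (ϖ : ℝ) * W.realPeriodRat = plusPeriod f) {s : ℚ} (hs : shaAn W = (s : ℂ))
    {a b : ℤ}
    (ha : ((ϖ : ℚ_[p]) * PowerSeries.coeff 1 L * padicLog p (cyclotomicGenerator p)).valuation = a)
    (hb : (padicRegulator Dh).valuation = b)
    (hle : a + 2 * (padicValNat p W.torsionOrder : ℤ) ≤ b + (padicValNat p W.tamagawaProduct : ℤ)) :
    BSDp W p :=
  have hReg : padicRegulator Dh ≠ 0 :=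
    schneiderHalf_nonsplit_of_cert (mordellWeilRank_eq_one_of_analyticRank hGZK hX.1) hc q Dh hq0 hq1
      hqj hDh
  bsdp_of_katoSurj_of_certNonsplit_of_padicValRat_shaAn_le W p hK hJn hHn hD hGZK hpar hp5 hX hsurj
    hns hc hs
    (padicValRat_shaAn_le_zero_of_disegni_nonsplit_of_vals W p hA hX.2.1 hX.2.2.1 hns hX.1 hq0 hq1
      hqj hf hL hDh hReg hϖ hs ha hb hle)

/-- **Per-pair closure, SPLIT `¬Ram` cell with a second multiplicative prime, from ONE REGMULT row +
an S-PADIC row — NO rounding hypothesis.** As `bsdp_of_katoSurj_of_certNonsplit_of_leadingCoeffVal`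
with ONE row `RegMult.CertSplit W p P m`, the Tate datum `Dq`, THE split `p`-adic `L`-function,
THE §4.2 height, and THREE valuation certificates `ha` (`ϖ·[T²]L·log_p(γ)² = A₂/(2c_∞)`), `hl`
(`𝓛_p(E)`), `hb` (regulator), `a + 2·ord_p #T ≤ l + b + ord_p ∏c`; the identity is Disegni 2020
Thm. 4 •2 (`hA2`, A186: `p ≥ 5`, `E[p]` irreducible — part of `ClassX11b` —, second multiplicative
prime `hm`, which is also Disegni's (∗) of the Kato road). CONDITIONAL; per pair; nothing booked.
[cite: Wuthrich2014, Thm. 3 (p. 383)] [cite: SteinWuthrich2013, Thm. 6.1 (p. 20), §4.2 (p. 16)]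
[cite: Disegni2020, Thm. 1 (§1.2), (∗); Thm. 4 (second bullet)] [cite: Miller2011LMS, Def. 1.1] -/
theorem bsdp_of_katoSurj_of_certSplit_of_leadingCoeffVal
    (hK : kato_charIdeal_dvd_multiplicative_of_surjective) (hJs : thm61_splitMultiplicative)
    (hHs : exists_isSplitMultCanonical) (hD : thm1_padicBSD_rankOne_multiplicative)
    (hA2 : Disegni2020.padicBSD_splitMult_rankOne)
    (hGZK : rank_eq_analyticRank_of_analyticRank_le_one) (hpar : nonempty_modularParametrizationData)
    (hp5 : 5 ≤ p) (hX : ClassX11b W p) (hsurj : Surj W p)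
    (hm : ∃ (m : ℕ) (_ : Fact m.Prime), m ≠ p ∧ W.HasMultiplicativeReductionAtPrime m)
    {P : W.toAffine.Point} {m : ℕ} (hc : CertSplit W p P m)
    (Dq : TateParameterData W p)
    {N : ℕ} [NeZero N] {f : CuspForm (Gamma0 N) 2} (hf : IsNewformOf W f)
    {L : PowerSeries ℚ_[p]} (hL : IsSplitMultPAdicLFunctionOf f p L)
    {Dh : PAdicHeightData W p} (hDh : IsSplitMultCanonical Dh Dq)
    {ϖ : ℚ} (hϖ : (ϖ : ℝ) * W.realPeriodRat = plusPeriod f) {s : ℚ} (hs : shaAn W = (s : ℂ))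
    {a l b : ℤ}
    (ha : ((ϖ : ℚ_[p]) * PowerSeries.coeff 2 L * padicLog p (cyclotomicGenerator p) ^ 2).valuation = a)
    (hl : (LInvariant Dq).valuation = l) (hb : (padicRegulator Dh).valuation = b)
    (hle : a + 2 * (padicValNat p W.torsionOrder : ℤ) ≤
      l + b + (padicValNat p W.tamagawaProduct : ℤ)) :
    BSDp W p :=
  have hReg : padicRegulator Dh ≠ 0 :=
    schneiderHalf_split_of_cert (mordellWeilRank_eq_one_of_analyticRank hGZK hX.1) hc Dq Dh hDh
  have hirr : W.HasIrreducibleModPGaloisRep p := hX.2.2.2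
  bsdp_of_katoSurj_of_certSplit_of_padicValRat_shaAn_le W p hK hJs hHs hD hGZK hpar hp5 hX hsurj
    Dq.split hm hc hs
    (padicValRat_le_zero_of_identity_split_of_vals W p (LInvariant_ne_zero_holds Dq) hReg
      (censusLeadingTermSplit_identity_of_disegni_of_secondPrime W p hA2 hp5 Dq hirr hX.1 hm hf hL
        hDh hϖ hs)
      ha hl hb hle)

end Padic

end RegMult

end Summit.BirchSwinnertonDyer.Rank1Residual.X11b

end
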